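import Literature.MathematicalPhysics.QuantumFieldTheory.Balaban1983to89.B1Ineq225BackgroundTorus
import Literature.MathematicalPhysics.QuantumFieldTheory.Balaban1983to89.B4Eq222SupDecay
import Literature.MathematicalPhysics.QuantumFieldTheory.Balaban1983to89.B1Ineq234LevelZero

/-!
# `Balaban1983to89.B1Ineq225DecayBackgroundTorus` — T. Bałaban, *(Higgs)₂,₃ quantum fields in a finite volume. I. A lower bound*,
# Commun. Math. Phys. **85** (1982) 603–626 [Balaban1982Higgs1], Prop. 2.1 (2.25) VALUE CLAUSE **WITH ITS DECAY FACTOR**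
# `exp(−δ₀(L^Kε)⁻¹dist(x, supp g))` ON `Ω = T_ε` AT THE REGULAR BACKGROUND `A^{(K),ε} ≠ 0` OF (3.29) — PROVED FOR THE (Higgs)₂,₃
# CARRIER from B4's Theorem (1.10) = [Balaban1983RegularityDecay] (2.12)–(2.13) ⇒ (2.22) on the torus (this seat's abstract
# `B4Eq222SupDecay` fed with gen 8's torus cubes `B1TorusCubeCover`/`B1TorusCubeLocality26` and cube inputs `B1TorusCubeBoxOp.cube_inputs`)

statement-level skeleton of published theorems with citation tags; proofs where landed; nothing here is a claim about the Yang–Mills mass gap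

PDF held: `paper:balaban1982-cmp85-higgs23-i` pp. 604, 610, 617 [PDF 2, 8, 15]; `paper:balaban1983-cmp89-regularity-decay` pp. 573, 575–579 [PDF 3, 5–9].

CITATION HEADER (lean-in-tree rule).  Cell `lit-balaban` (HOME `run/shared/lean/pub/lit-balaban/`), Phase-2 proof seat **p35** gen 9 (unit
`lit-balaban-p35`); SKELETON rows **B1.Prop2.1** ((2.25) value clause WITH DECAY, `A = A^{(K),ε} ≠ 0`, `Ω = T_ε`: MODEL INSTANCE) and
**B4.Thm@573** ((1.10) value member with `exp(−δ₀dist)` on the torus at a regular background).  USED BY NAME, never restated: gen 8's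
`B1TorusCubeCover`/`B1TorusCubeLocality26`/`B1TorusCubeChart`/`B1TorusCubeBoxOp.cube_inputs`/`B1Ineq225BackgroundTorus.norm_sderiv_bgVec_le`,
this seat's `B4Eq222SupDecay.norm_inverse_apply_le_of_dist`, p14's `B1Ineq225DerivZeroFieldTorus.covDeriv_propagatorK_sup_bound`, r14's
`B1Ineq234LevelZero.tdist_triangle_real`, r15's `B1Ineq234Concrete.tdist_self`, the typer's `HiggsLattice.Site.tdist` ((1.3)), `HiggsCovariance`.
WHAT IS PRINTED (v1.1: quotation corrected per referee ref-1 gen 53 F4; no declaration changed).  [B1] p. 610 [PDF 8], verbatim: *"the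
rescaled propagator is given by G_k(Ω, A) = (−Δ^{η,N}_{A,Ω} + m²(L^kε)² + a_kP_k(A))^{−1}. (2.22)"*; *"Proposition 2.1. … Then for e(L^kε)
sufficiently small and α < 1 there exist positive constants δ₀, c₀, R₀ independent of A, k, Ω and depending on d, a, M only, c₀ on α also,
such that for an arbitrary function f : Ω → R^N we have … |(D^η_{A,μ}G_k(Ω, A)f)(x)|, |(G_k(Ω, A)f)(x)| ≦ c₀ exp(−δ₀ dist(x, supp f))‖f‖_∞ (2.25)
for x ∈ Ω, dist(x, Ω^c) ≧ R₀."*  READING proved here (unit conversion to the ε-lattice propagator (2.20), `G^ε_k = (L^kε)²·G_k` after rescaling;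
not a printed display): `|(G^ε_k(Ω,A)f)(x)| ≦ c₀(L^kε)² exp(−δ₀(L^kε)^{−1}dist_ε(x, supp f))‖f‖_∞` = the shape of `norm_propagatorK_bgVec_decay_of_cubes`;
this file's constants depend on `d, L, N, e, q, a, μ₀², m², ε₀` and `K₀` as declared at each theorem (the print's uniformity = the sentence quoted).
WHAT THIS FILE PROVES (kernel-checked, zero `sorry`, theorems only; axioms standard).
* §1 `tdist_le_of_near` — the row cores `S_j = {|y − Mj| ≦ r}` of the torus cubes have (1.3)-diameter `≦ 2r` (lattice units).
* §2 **THEOREM (1.10) WITH ITS DECAY FACTOR ON `T_ε`, MODULO THE CUBE INPUTS** — `norm_propagatorK_univ_decay_le`: for ANY `A`, `m² > 0`,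
  `a_K ≧ 0`, given the per-cube inputs `‖G_j(h_jψ)‖ ≦ γ‖ψ‖`, `‖K_jG_j(h_jψ)‖ ≦ β‖ψ‖` and `δ ≧ 0` with `2^dβe^{2δ·rS} ≦ ½`:
  `‖(G^ε_K(T_ε,A)φ)(x)‖ ≦ 2·2^dγe^{2δ·rS}·e^{−δD}·M` for `‖φ‖ ≦ M` vanishing within (1.3)-distance `D` of `x` (`B4Eq222SupDecay` on the torus
  cube system of gen 8, weight = truncated (1.3)-distance to `x`).
* §3 `cube_inputs_bgVec` — gen 8's discharge of the two cube inputs at `Ã_j` for `A = A^{(K),ε}` (`γ = C_γ(L^Kε)²`, `β = C_β/K₀`,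
  threshold `r·L^Kε ≦ c_A(K₀)`), packaged once.
* §4 **(2.25) VALUE CLAUSE WITH DECAY AT `A^{(K),ε}`** — `norm_propagatorK_bgVec_decay_of_cubes`: constants `c₀ > 0`, `K₀min`, and per cube
  size `K₀` a threshold `c_A(K₀) > 0` and a rate `δ₀(K₀) > 0` (*"δ₀ … depending on d, M only"*: `K₀` is the print's `M`) with
  `‖(G^ε_K(T_ε, A^{(K),ε})g)(x)‖ ≦ c₀(L^Kε)²·e^{−δ₀(K₀)·D/L^K}·M′` for `‖g‖ ≦ M′` vanishing within (1.3)-distance `D` of `x`, under gen 8's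
  side conditions (`D/L^K = (L^Kε)⁻¹·(εD)` is the printed exponent); packagings `norm_propagatorK_bgVec_decay` (`K₀ ∣ M`, `3K₀ ≦ 2M`) and
  `norm_propagatorK_bgVec_decay_bigBlocks` (`K₀ = M`).  `D = 0` is gen 8's `B1Ineq225BackgroundTorus.norm_propagatorK_bgVec_le_of_cubes`.
HONEST SCOPE: value clause only (no derivative/Hölder clause (2.24)); `Ω = T_ε`; tori with `M·L′_μ = L^m`, `L` odd; constants existential
(functions of `d, L, a, μ₀², m²ε₀², N, (e,q)`; `c_A`, `δ₀` also of the cube size); the route to (2.22) is the weighted form of (2.12) declared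
in `B4Eq222SupDecay` (not the term-by-term walk count).  Unit `lit-balaban-p35` gen 9 (literature-prover-lit-balaban-p35-g9-0).
-/

open scoped BigOperators

namespace Literature.MathematicalPhysics.QuantumFieldTheory.Balaban1983to89.B1Ineq225DecayBackgroundTorus

open Literature.MathematicalPhysics.QuantumFieldTheory.Balaban1983to89.HiggsLattice (ChargeData sderiv)
open Literature.MathematicalPhysics.QuantumFieldTheory.Balaban1983to89.HiggsCovariance (propagatorK covOpK)
open Literature.MathematicalPhysics.QuantumFieldTheory.Balaban1983to89.HiggsCovariancePos (isUnit_covOpK covOpK_mul_propagatorK)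
open Literature.MathematicalPhysics.QuantumFieldTheory.Balaban1983to89.B3MultiscaleFields (toSite zeroCharge)
open Literature.MathematicalPhysics.QuantumFieldTheory.Balaban1983to89.B1Eq31Concrete (bgVec)
open Literature.MathematicalPhysics.QuantumFieldTheory.Balaban1983to89.B1Eq211ZeroFieldTorus (Shape)
open Literature.MathematicalPhysics.QuantumFieldTheory.Balaban1983to89.B1Ineq225DerivZeroFieldTorus (covDeriv_propagatorK_sup_bound)
open Literature.MathematicalPhysics.QuantumFieldTheory.Balaban1983to89.B1TorusCubeCover (half Lab Near cube hTor card_filter_near_le sum_hTor_sq abs_hTor_le_one)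
open Literature.MathematicalPhysics.QuantumFieldTheory.Balaban1983to89.B1TorusCubeLocality26 (rS cubeVec covOpK_hTor_agree commutator_row_zero near_rS_of_hTor_ne_zero rS_succ_lt_half)
open Literature.MathematicalPhysics.QuantumFieldTheory.Balaban1983to89.B1TorusCubeChart (dd castD toT toT_add_e1)
open Literature.MathematicalPhysics.QuantumFieldTheory.Balaban1983to89.B1TorusCubeBoxOp (acT cube_inputs)
open Literature.MathematicalPhysics.QuantumFieldTheory.Balaban1983to89.B4Lemma22ReduceZero (Box)
open Literature.MathematicalPhysics.QuantumFieldTheory.Balaban1983to89.B4Lower18Regular (e1)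
open Literature.MathematicalPhysics.QuantumFieldTheory.Balaban1983to89.B1Ineq225BackgroundTorus (apply_shift_sub_eq norm_sderiv_bgVec_le three_half_le_sites)
open Literature.MathematicalPhysics.QuantumFieldTheory.Balaban1983to89.B4Eq222SupDecay (norm_inverse_apply_le_of_dist)
open Literature.MathematicalPhysics.QuantumFieldTheory.Balaban1983to89.B1Ineq234LevelZero (tdist_comm tdist_triangle_real)
open Literature.MathematicalPhysics.QuantumFieldTheory.Balaban1983to89.B1Ineq234Concrete (tdist_self)

variable {P : HiggsLattice.Params} {N : ℕ}

/-! ## §1 The (1.3)-diameter of the row cores `{|y − Mj| ≦ r}` -/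

section Geometry

variable {K K₀ : ℕ}

/-- **Two sites within `r` of the same centre `Mj` are at (1.3)-distance `≦ 2r`** (coordinate-wise `y_μ − y′_μ = z_μ − z′_μ` with
`|z_μ|, |z′_μ| ≦ r`; the torus distance of a coordinate pair is at most the length of any integer representative of their difference).
[cite: Balaban1982Higgs1, (1.3) p.604] [cite: Balaban1983RegularityDecay, §2 p.575] -/
theorem tdist_le_of_near {r : ℕ} {j : Lab P K K₀} {y y' : HiggsLattice.Site P 0} (hy : Near K K₀ r j y) (hy' : Near K K₀ r j y') :
    HiggsLattice.Site.tdist y y' ≤ 2 * r := by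
  unfold HiggsLattice.Site.tdist
  refine Finset.sup_le fun μ _ => ?_
  obtain ⟨z, hz, e⟩ := hy μ
  obtain ⟨z', hz', e'⟩ := hy' μ
  simp only [Finset.mem_Icc] at hz hz'
  have hsub : y μ - y' μ = ((z - z' : ℤ) : ZMod (P.sitesPerDir 0 μ)) := by rw [e, e']; push_cast; ring
  have hsub' : y' μ - y μ = ((z' - z : ℤ) : ZMod (P.sitesPerDir 0 μ)) := by rw [e, e']; push_cast; ring
  rcases le_or_gt z' z with hle | hlt
  · obtain ⟨k, hk⟩ := Int.eq_ofNat_of_zero_le (sub_nonneg.mpr hle)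
    have hval : (y μ - y' μ).val = k % P.sitesPerDir 0 μ := by rw [hsub, hk, Int.cast_natCast, ZMod.val_natCast]
    calc min (y μ - y' μ).val (y' μ - y μ).val ≤ (y μ - y' μ).val := min_le_left _ _
      _ = k % P.sitesPerDir 0 μ := hval
      _ ≤ k := Nat.mod_le _ _
      _ ≤ 2 * r := by omega
  · obtain ⟨k, hk⟩ := Int.eq_ofNat_of_zero_le (sub_nonneg.mpr hlt.le)
    have hval : (y' μ - y μ).val = k % P.sitesPerDir 0 μ := by rw [hsub', hk, Int.cast_natCast, ZMod.val_natCast]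
    calc min (y μ - y' μ).val (y' μ - y μ).val ≤ (y' μ - y μ).val := min_le_right _ _
      _ = k % P.sitesPerDir 0 μ := hval
      _ ≤ k := Nat.mod_le _ _
      _ ≤ 2 * r := by omega

/-- `8·rS ≦ 5M + 8L^K` for the row radius `rS = ⌊⅝M⌋ + L^K` (`M = L^KK₀` fine sites). [cite: Balaban1983RegularityDecay, (2.7) p.576] -/
theorem eight_rS_le : 8 * rS P K K₀ ≤ 5 * half P K K₀ + 8 * P.L ^ K := by
  unfold rS
  omega

end Geometry

/-! ## §2 Theorem (1.10) with its decay factor on `T_ε`, modulo the cube inputs -/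

section Torus

variable {K K₀ : ℕ}

/-- **THEOREM (1.10), VALUE MEMBER WITH ITS DECAY FACTOR, ON THE TORUS `Ω = T_ε` — modulo the cube inputs.**  `m² > 0`, `a_K ≧ 0`,
`K ≦ K_P`, `K₀ ∣ M_P`, `K₀ ≧ 8`, ANY `A`; per-cube inputs `‖G_j(h_jψ)‖_∞ ≦ γ‖ψ‖_∞`, `‖(H_jh_j − h_jH_j)G_j(h_jψ)‖_∞ ≦ β‖ψ‖_∞`, and `δ ≧ 0`
with `2^d·β·e^{δ·2rS} ≦ ½` (`2rS` = the (1.3)-diameter of the row cores; the choice of `M` on p. 579).  Then for `‖φ(y)‖ ≦ M′` vanishing at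
the sites within (1.3)-distance `< D` of `x`: `‖(G^ε_K(T_ε, A)φ)(x)‖ ≦ 2·2^d·γe^{δ·2rS}·e^{−δD}·M′` — (2.12)–(2.13) summed in the
`e^{δ·dist(x,·)}`-weighted sup norm (`B4Eq222SupDecay.norm_inverse_apply_le_of_dist` on gen 8's torus cube system).
[cite: Balaban1983RegularityDecay, Theorem (1.10) p.573; (2.12)–(2.13) p.577; (2.22) p.579] [cite: Balaban1982Higgs1, Prop. 2.1 (2.25) p.610] -/
theorem norm_propagatorK_univ_decay_le (C : ChargeData N) (hK : K ≤ P.K) (hK₀ : K₀ ∣ P.M) (hK₀8 : 8 ≤ K₀) {msq : ℝ}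
    (hmsq : 0 < msq) (a : ℝ) (hak : 0 ≤ B1.aSeq a P.L K) (A : HiggsLattice.VecField P 0) {γ β : ℝ} (hγ : 0 ≤ γ) (hβ : 0 ≤ β)
    (hGj : ∀ (j : Lab P K K₀) (ψ : HiggsLattice.ScalarField P 0 N),
      ‖propagatorK C (cube K K₀ j) (cubeVec K K₀ j A) msq a K (hTor K K₀ j • ψ)‖ ≤ γ * ‖ψ‖)
    (hKj : ∀ (j : Lab P K K₀) (ψ : HiggsLattice.ScalarField P 0 N),
      ‖covOpK C (cube K K₀ j) (cubeVec K K₀ j A) msq a K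
          (hTor K K₀ j • propagatorK C (cube K K₀ j) (cubeVec K K₀ j A) msq a K (hTor K K₀ j • ψ))
        - hTor K K₀ j • covOpK C (cube K K₀ j) (cubeVec K K₀ j A) msq a K
          (propagatorK C (cube K K₀ j) (cubeVec K K₀ j A) msq a K (hTor K K₀ j • ψ))‖ ≤ β * ‖ψ‖)
    {δ : ℝ} (hδ : 0 ≤ δ) (hsmall : (2 : ℝ) ^ P.d * β * Real.exp (δ * (2 * rS P K K₀)) ≤ 1 / 2)
    (φ : HiggsLattice.ScalarField P 0 N) {M : ℝ} (hφ : ∀ y, ‖φ y‖ ≤ M) {D : ℝ} (hD0 : 0 ≤ D) (x : HiggsLattice.Site P 0)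
    (hD : ∀ y, φ y ≠ 0 → D ≤ (HiggsLattice.Site.tdist x y : ℝ)) :
    ‖propagatorK C Finset.univ A msq a K φ x‖
      ≤ 2 * 2 ^ P.d * (γ * Real.exp (δ * (2 * rS P K K₀))) * Real.exp (-(δ * D)) * M := by
  classical
  have hK₀' : 1 ≤ K₀ := le_trans (by norm_num) hK₀8
  have h := norm_inverse_apply_le_of_dist (X := HiggsLattice.Site P 0) (E := EuclideanSpace ℝ (Fin N)) (J := Lab P K K₀)
    (covOpK C Finset.univ A msq a K) (isUnit_covOpK C Finset.univ A hmsq a K hak)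
    (fun j => covOpK C (cube K K₀ j) (cubeVec K K₀ j A) msq a K)
    (fun j => propagatorK C (cube K K₀ j) (cubeVec K K₀ j A) msq a K)
    (fun j => covOpK_mul_propagatorK C (cube K K₀ j) (cubeVec K K₀ j A) hmsq a K hak)
    (hTor K K₀) (sum_hTor_sq hK hK₀ hK₀') (abs_hTor_le_one hK hK₀ hK₀')
    (fun j ψ => covOpK_hTor_agree C hK hK₀ hK₀8 j A msq a ψ)
    (fun j => Finset.univ.filter (Near K K₀ (rS P K K₀) j))
    (fun j x hx => by
      rw [Finset.mem_filter]; exact ⟨Finset.mem_univ _, near_rS_of_hTor_ne_zero hK hK₀ hK₀8 hx⟩)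
    (fun j θ x hx => commutator_row_zero C hK hK₀ hK₀8 j A msq a θ (fun h => hx (by
      rw [Finset.mem_filter]; exact ⟨Finset.mem_univ _, h⟩)))
    (2 ^ P.d)
    (fun x => by
      have e : (Finset.univ.filter fun j : Lab P K K₀ => x ∈ Finset.univ.filter (Near K K₀ (rS P K K₀) j))
          = Finset.univ.filter fun j : Lab P K K₀ => Near K K₀ (rS P K K₀) j x := by
        ext j'; simp
      rw [e]
      exact card_filter_near_le hK hK₀ hK₀' (lt_trans (Nat.lt_succ_self _) (rS_succ_lt_half hK₀8)) x)
    hγ hβ hGj hKj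
    (fun x y => (HiggsLattice.Site.tdist x y : ℝ)) (fun x => by exact_mod_cast tdist_self x) (fun x y => Nat.cast_nonneg _)
    (fun x y z => tdist_triangle_real x y z)
    (diam := 2 * rS P K K₀)
    (fun j y hy y' hy' => by
      rw [Finset.mem_filter] at hy hy'
      exact_mod_cast tdist_le_of_near hy.2 hy'.2)
    hδ (by push_cast; exact hsmall) φ hφ hD0 x hD
  have e2 : ((2 ^ P.d : ℕ) : ℝ) = 2 ^ P.d := by push_cast; ring
  rw [e2] at h
  exact h

end Torus

/-! ## §3 The cube inputs at `Ã_j` for the background `A^{(K),ε}` -/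

section CubeInputs

set_option maxHeartbeats 400000 in
/-- **THE TWO CUBE INPUTS AT THE BACKGROUND `A^{(K),ε}` OF (3.29)** (gen 8's discharge, packaged): `C_γ, C_β > 0` and thresholds
`c_A(K₀) > 0` such that for `K₀ ≧ 8`, on every torus with `K₀ ∣ M`, at every level `1 ≦ K ≦ K_P` with `3·L^KK₀ ≦ |T_ε|_μ`, `L^Kε ≦ ε₀`, for
`r·L^Kε ≦ c_A(K₀)`, `|A| ≦ r`, every cube satisfies `‖G_j(h_jψ)‖_∞ ≦ C_γ(L^Kε)²‖ψ‖_∞` ((2.17)) and `‖K_jG_j(h_jψ)‖_∞ ≦ (C_β/K₀)‖ψ‖_∞` ((2.20))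
at `Ã_j = cubeVec(A^{(K),ε})` — `B1TorusCubeBoxOp.cube_inputs` (charge `e₁`, pair `(1, ½)`) + the (2.23)-regularity `norm_sderiv_bgVec_le`.
[cite: Balaban1982Higgs1, (2.23) p.610, (3.29) p.617] [cite: Balaban1983RegularityDecay, Lemma 2.2 (2.17) p.578, (2.20) p.578] -/
theorem cube_inputs_bgVec (d L : ℕ) (hd : 1 ≤ d) (hL : Odd L ∧ 1 < L) {a : ℝ} (ha : 0 < a)
    {mu0sq msq : ℝ} (hmu : 0 < mu0sq) (hmsq : 0 < msq) (N : ℕ) (C : ChargeData N) (ε₀ : ℝ) :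
    ∃ Cγ Cβ : ℝ, 0 < Cγ ∧ 0 < Cβ ∧ ∃ cA : ℕ → ℝ, (∀ K₀, 0 < cA K₀) ∧ ∀ K₀ : ℕ, 8 ≤ K₀ →
      ∀ (P : HiggsLattice.Params) (_S : Shape P), P.d = d → P.L = L → K₀ ∣ P.M →
      ∀ {K : ℕ}, 1 ≤ K → K ≤ P.K → (∀ μ, 3 * half P K K₀ ≤ P.sitesPerDir 0 μ) → P.mesh K ≤ ε₀ →
      ∀ {r : ℝ}, r * P.mesh K ≤ cA K₀ →
      ∀ A : HiggsLattice.VecField P K, (∀ x, ‖toSite A x‖ ≤ r) → ∀ j : Lab P K K₀,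
        (∀ ψ : HiggsLattice.ScalarField P 0 N,
            ‖propagatorK C (cube K K₀ j) (cubeVec K K₀ j (bgVec mu0sq a K A)) msq a K (hTor K K₀ j • ψ)‖
              ≤ Cγ * P.mesh K ^ 2 * ‖ψ‖) ∧
        (∀ ψ : HiggsLattice.ScalarField P 0 N,
            ‖covOpK C (cube K K₀ j) (cubeVec K K₀ j (bgVec mu0sq a K A)) msq a K
                (hTor K K₀ j • propagatorK C (cube K K₀ j) (cubeVec K K₀ j (bgVec mu0sq a K A)) msq a K (hTor K K₀ j • ψ))
              - hTor K K₀ j • covOpK C (cube K K₀ j) (cubeVec K K₀ j (bgVec mu0sq a K A)) msq a K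
                (propagatorK C (cube K K₀ j) (cubeVec K K₀ j (bgVec mu0sq a K A)) msq a K (hTor K K₀ j • ψ))‖
              ≤ Cβ / K₀ * ‖ψ‖) := by
  have hℓ0 : 1 ≤ L - 1 := by have := hL.2; omega
  -- the constants of the cube inputs (Lemma 2.2 at charge 1) and of the zero-field derivative clause for the vector propagator
  obtain ⟨Cγ, Cβ, hCγ, hCβ, hci⟩ := cube_inputs C (d - 1) (L - 1) hℓ0 a a (msq * ε₀ ^ 2) ha
  obtain ⟨c', hc', hder⟩ := covDeriv_propagatorK_sup_bound d L d hd hL ha hmu.le ε₀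
  -- the charge threshold `e₁(K₀)` of the cube inputs for the regularity pair `(1, ½)`, as a function of the cube size
  have hci' : ∀ K₀ : ℕ, ∃ e₁ : ℝ, 0 < e₁ ∧ _ := fun K₀ => hci 1 (1 / 2) zero_le_one (by norm_num) (max K₀ 8) (le_max_right _ _)
  choose e₁ he₁ hthr' using hci'
  refine ⟨Cγ, Cβ, hCγ, hCβ, fun K₀ => Real.sqrt (e₁ K₀) / (|C.e| * a * c' + 1), fun K₀ => by have := he₁ K₀; positivity,
    fun K₀ hK₀8 => ?_⟩
  have hmax : max K₀ 8 = K₀ := max_eq_left hK₀8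
  have hthr := hthr' K₀
  rw [hmax] at hthr
  intro P S hPd hPL hK₀M K hK1 hK hN3 hε r hr A hA j
  subst hPd
  have he₁K := he₁ K₀
  have hL1 : (1 : ℝ) < P.L := by rw [hPL]; exact_mod_cast hL.2
  have hdd : dd P = P.d - 1 := rfl
  have hPL1 : P.L - 1 = L - 1 := by rw [hPL]
  have hmesh : 0 < P.mesh K := P.mesh_pos K
  have hmesh0 : 0 < P.mesh 0 := P.mesh_pos 0
  have hcap : msq * P.mesh K ^ 2 ≤ msq * ε₀ ^ 2 :=
    mul_le_mul_of_nonneg_left (pow_le_pow_left₀ hmesh.le hε 2) hmsq.le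
  have hr0 : 0 ≤ r := (norm_nonneg _).trans (hA (HiggsAveraging.blockIter K (default : HiggsLattice.Site P 0)))
  set Abg : HiggsLattice.VecField P 0 := bgVec mu0sq a K A with hAbg
  -- the regularity (2.23) of the background in the lineage's (1.7) form, at charge `e_c = e₁`, pair `(1, ½)`
  have hnR : ((((P.L - 1 + 1) ^ K : ℕ)) : ℝ) = (P.L : ℝ) ^ K := by
    rw [B1TorusCubeChart.predL_succ, Nat.cast_pow]
  have hmeshK : P.mesh K = (P.L : ℝ) ^ K * P.mesh 0 := by
    unfold HiggsLattice.Params.mesh; ring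
  have hD' := norm_sderiv_bgVec_le hK1 hL1 ha
    (fun ψ M' hψ b => hder P S rfl hPL (zeroCharge P.d) hK1 hK hε ψ M' hψ b) A hA
  have h17 : ∀ y ∈ Box (dd P) (P.L - 1) K (B1TorusCubeChart.M2 P K₀), ∀ i i' : Fin (dd P + 1),
      |acT K K₀ j ((((P.L - 1 + 1) ^ K : ℕ) : ℝ) * P.mesh 0 * C.e / e₁ K₀) Abg (y + e1 i) i'
        - acT K K₀ j ((((P.L - 1 + 1) ^ K : ℕ) : ℝ) * P.mesh 0 * C.e / e₁ K₀) Abg y i'|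
        ≤ 1 * e₁ K₀ ^ ((1 : ℝ) / 2 - 1) / ((P.L - 1 + 1) ^ K : ℕ) := by
    intro y _ i i'
    unfold acT
    rw [toT_add_e1, ← mul_sub, abs_mul, apply_shift_sub_eq, hnR]
    have hsd := (le_of_eq_of_le (Real.norm_eq_abs _).symm
      (PiLp.norm_apply_le (sderiv (toSite Abg) ⟨toT K K₀ j y, castD P i⟩) (castD P i'))).trans (hD' ⟨toT K K₀ j y, castD P i⟩)
    have hpow : (0 : ℝ) < (P.L : ℝ) ^ K := by positivity
    have hσ : |(P.L : ℝ) ^ K * P.mesh 0 * C.e / e₁ K₀| = (P.L : ℝ) ^ K * P.mesh 0 * |C.e| / e₁ K₀ := by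
      rw [abs_div, abs_mul, abs_mul, abs_of_pos hpow, abs_of_pos hmesh0, abs_of_pos he₁K]
    rw [hσ, abs_mul, abs_of_pos hmesh0]
    have hexp : e₁ K₀ ^ ((1 : ℝ) / 2 - 1) = (Real.sqrt (e₁ K₀))⁻¹ := by
      rw [show (1 : ℝ) / 2 - 1 = -(1 / 2) by norm_num, Real.rpow_neg he₁K.le, Real.sqrt_eq_rpow]
    rw [hexp, one_mul]
    -- the key smallness: `r·L^Kε·(|e| a c′) ≦ √e₁`, from `r·L^Kε ≦ c_A`
    have hkey : r * P.mesh K * (|C.e| * a * c') ≤ Real.sqrt (e₁ K₀) := by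
      have h1 : r * P.mesh K * (|C.e| * a * c') ≤ r * P.mesh K * (|C.e| * a * c' + 1) :=
        mul_le_mul_of_nonneg_left (by linarith) (by positivity)
      refine h1.trans ?_
      have hr' := hr
      simp only at hr'
      rw [le_div_iff₀ (by positivity)] at hr'
      exact hr'
    calc (P.L : ℝ) ^ K * P.mesh 0 * |C.e| / e₁ K₀ * (P.mesh 0 * |(sderiv (toSite Abg) ⟨toT K K₀ j y, castD P i⟩) (castD P i')|)
        ≤ (P.L : ℝ) ^ K * P.mesh 0 * |C.e| / e₁ K₀ * (P.mesh 0 * (a * c' * (P.mesh K)⁻¹ * r)) :=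
          mul_le_mul_of_nonneg_left (mul_le_mul_of_nonneg_left hsd hmesh0.le) (by positivity)
      _ = (r * P.mesh K * (|C.e| * a * c')) / (e₁ K₀ * (P.L : ℝ) ^ K) := by
          rw [hmeshK]; field_simp
      _ ≤ Real.sqrt (e₁ K₀) / (e₁ K₀ * (P.L : ℝ) ^ K) := div_le_div_of_nonneg_right hkey (by positivity)
      _ = (Real.sqrt (e₁ K₀))⁻¹ / ((P.L : ℝ) ^ K) := by
          rw [← Real.sqrt_div_self, div_div]
  exact hthr P hdd hPL1 K hK1 hK hK₀M hN3 a msq le_rfl le_rfl hmsq hcap j Abg (e₁ K₀) he₁K le_rfl h17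

end CubeInputs

/-! ## §4 (2.25), value clause with its decay factor, on `T_ε` at the background `A^{(K),ε}` -/

section Main

/-- **PROP. 2.1 (2.25), VALUE CLAUSE WITH ITS DECAY FACTOR, ON `Ω = T_ε` AT THE BACKGROUND `A^{(K),ε}` OF (3.29) — B4's THEOREM (1.10)
VALUE MEMBER WITH `exp(−δ₀dist)` FOR THE (Higgs)₂,₃ CARRIER AT A REGULAR `A ≠ 0`.**  For `d ≧ 1`, odd `L > 1`, `a, μ₀², m² > 0`, `N`, `(e, q)`,
`ε₀`: constants `c₀ > 0`, `K₀min`, and per cube size `K₀` a threshold `c_A(K₀) > 0` and a rate `δ₀(K₀) > 0`, such that for `K₀ ≧ K₀min`, on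
every torus `M·L′_μ = L^m` with `K₀ ∣ M`, at every level `1 ≦ K ≦ K_P` with `3·L^KK₀ ≦ |T_ε|_μ`, `L^Kε ≦ ε₀`, for `r·L^Kε ≦ c_A(K₀)`, every
`|A(x)| ≦ r`, every `g` with `‖g‖_∞ ≦ M′` vanishing at the sites within (1.3)-distance `< D` of `x` (`D ≧ 0`, lattice units):
`‖(G^ε_K(T_ε, A^{(K),ε})g)(x)‖ ≦ c₀(L^Kε)²·exp(−δ₀(K₀)·D/L^K)·M′` (`D/L^K = (L^Kε)⁻¹·(εD)`, the printed exponent).  Proof = §2 with §3,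
`δ = log 2/(2rS)` (`e^{δ·2rS} = 2`; `K₀ ≧ 2^{d+2}C_β`), `δ₀(K₀) = 4log 2/(5K₀ + 8)` from `8rS ≦ (5K₀ + 8)L^K`.
[cite: Balaban1982Higgs1, Prop. 2.1 (2.25) p.610; (3.29) p.617] [cite: Balaban1983RegularityDecay, Theorem (1.10) p.573; (2.22) p.579] -/
theorem norm_propagatorK_bgVec_decay_of_cubes (d L : ℕ) (hd : 1 ≤ d) (hL : Odd L ∧ 1 < L) {a : ℝ} (ha : 0 < a)
    {mu0sq msq : ℝ} (hmu : 0 < mu0sq) (hmsq : 0 < msq) (N : ℕ) (C : ChargeData N) (ε₀ : ℝ) :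
    ∃ c₀ : ℝ, 0 < c₀ ∧ ∃ K₀min : ℕ, ∃ cA δA : ℕ → ℝ, (∀ K₀, 0 < cA K₀ ∧ 0 < δA K₀) ∧ ∀ K₀ : ℕ, K₀min ≤ K₀ →
      ∀ (P : HiggsLattice.Params) (_S : Shape P), P.d = d → P.L = L → K₀ ∣ P.M →
      ∀ {K : ℕ}, 1 ≤ K → K ≤ P.K → (∀ μ, 3 * half P K K₀ ≤ P.sitesPerDir 0 μ) → P.mesh K ≤ ε₀ →
      ∀ {r : ℝ}, r * P.mesh K ≤ cA K₀ →
      ∀ A : HiggsLattice.VecField P K, (∀ x, ‖toSite A x‖ ≤ r) →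
        ∀ (g : HiggsLattice.ScalarField P 0 N) (M D : ℝ), (∀ x, ‖g x‖ ≤ M) → 0 ≤ D →
          ∀ x, (∀ z, g z ≠ 0 → D ≤ (HiggsLattice.Site.tdist x z : ℝ)) →
            ‖propagatorK C Finset.univ (bgVec mu0sq a K A) msq a K g x‖
              ≤ c₀ * P.mesh K ^ 2 * Real.exp (-(δA K₀ * (D / (P.L : ℝ) ^ K))) * M := by
  obtain ⟨Cγ, Cβ, hCγ, hCβ, cA, hcA, hcube⟩ := cube_inputs_bgVec d L hd hL ha hmu hmsq N C ε₀
  have hlog2 : 0 < Real.log 2 := Real.log_pos (by norm_num)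
  refine ⟨4 * 2 ^ d * Cγ, by positivity, max 8 (⌈(2 : ℝ) ^ (d + 2) * Cβ⌉₊), cA, fun K₀ => Real.log 2 * 4 / (5 * K₀ + 8),
    fun K₀ => ⟨hcA K₀, div_pos (mul_pos hlog2 (by norm_num)) (by positivity)⟩, fun K₀ hK₀ => ?_⟩
  have hK₀8 : 8 ≤ K₀ := le_trans (le_max_left _ _) hK₀
  have hK₀C : (2 : ℝ) ^ (d + 2) * Cβ ≤ K₀ :=
    (Nat.le_ceil _).trans (by exact_mod_cast le_trans (le_max_right _ _) hK₀)
  have h22 : (2 : ℝ) ^ (d + 2) = 2 ^ d * 4 := by rw [pow_add]; norm_num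
  rw [h22] at hK₀C
  intro P S hPd hPL hK₀M K hK1 hK hN3 hε r hr A hA g M D hg hD0 x hD
  have hcj := fun j => hcube K₀ hK₀8 P S hPd hPL hK₀M hK1 hK hN3 hε hr A hA j
  subst hPd
  have hL1 : (1 : ℝ) < P.L := by rw [hPL]; exact_mod_cast hL.2
  have hmesh : 0 < P.mesh K := P.mesh_pos K
  have hakP : 0 ≤ B1.aSeq a P.L K := (B1.aSeq_pos ha hL1 hK1).le
  have hM0 : 0 ≤ M := (norm_nonneg _).trans (hg x)
  have hK₀pos : (0 : ℝ) < K₀ := by exact_mod_cast (show 0 < K₀ by omega)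
  have hLK : (1 : ℝ) ≤ (P.L : ℝ) ^ K := by exact_mod_cast Nat.one_le_pow K P.L P.hL
  -- the rate `δ = log 2/(2rS)`: `e^{δ·2rS} = 2`
  have hrS : (0 : ℝ) < rS P K K₀ := by
    have : 1 ≤ rS P K K₀ := by unfold rS; have := Nat.one_le_pow K P.L P.hL; omega
    exact_mod_cast this
  set δ : ℝ := Real.log 2 / (2 * rS P K K₀) with hδ_def
  have hδ0 : 0 ≤ δ := by positivity
  have hexp : Real.exp (δ * (2 * rS P K K₀)) = 2 := by
    rw [hδ_def, div_mul_cancel₀ _ (by positivity), Real.exp_log two_pos]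
  have hsmall : (2 : ℝ) ^ P.d * (Cβ / K₀) * Real.exp (δ * (2 * rS P K K₀)) ≤ 1 / 2 := by
    rw [hexp]
    have e : (2 : ℝ) ^ P.d * (Cβ / K₀) * 2 = (2 ^ P.d * 2 * Cβ) / K₀ := by ring
    rw [e, div_le_iff₀ hK₀pos]
    linarith
  have hmain := norm_propagatorK_univ_decay_le C hK hK₀M hK₀8 hmsq a hakP (bgVec mu0sq a K A) (γ := Cγ * P.mesh K ^ 2)
    (β := Cβ / K₀) (by positivity) (by positivity) (fun j ψ => (hcj j).1 ψ) (fun j ψ => (hcj j).2 ψ) hδ0 hsmall g hg hD0 x hD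
  rw [hexp] at hmain
  -- `δ·D ≧ δ₀(K₀)·D/L^K` from `8rS ≦ 5M + 8L^K = (5K₀ + 8)L^K`
  have h8 : 8 * (rS P K K₀ : ℝ) ≤ (5 * (K₀ : ℝ) + 8) * (P.L : ℝ) ^ K := by
    have h := eight_rS_le (P := P) (K := K) (K₀ := K₀)
    have h' : ((8 * rS P K K₀ : ℕ) : ℝ) ≤ ((5 * half P K K₀ + 8 * P.L ^ K : ℕ) : ℝ) := by exact_mod_cast h
    unfold half at h'
    push_cast at h'
    linarith
  have hcmp : Real.log 2 * 4 / (5 * (K₀ : ℝ) + 8) * (D / (P.L : ℝ) ^ K) ≤ δ * D := by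
    rw [hδ_def, div_mul_div_comm, div_mul_eq_mul_div, div_le_div_iff₀ (by positivity) (by positivity)]
    have hlogD : 0 ≤ Real.log 2 * D := mul_nonneg hlog2.le hD0
    calc Real.log 2 * 4 * D * (2 * (rS P K K₀ : ℝ)) = Real.log 2 * D * (8 * (rS P K K₀ : ℝ)) := by ring
      _ ≤ Real.log 2 * D * ((5 * (K₀ : ℝ) + 8) * (P.L : ℝ) ^ K) := mul_le_mul_of_nonneg_left h8 hlogD
  have hexpD : Real.exp (-(δ * D)) ≤ Real.exp (-(Real.log 2 * 4 / (5 * (K₀ : ℝ) + 8) * (D / (P.L : ℝ) ^ K))) :=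
    Real.exp_le_exp.2 (by linarith)
  calc ‖propagatorK C Finset.univ (bgVec mu0sq a K A) msq a K g x‖
      ≤ 2 * 2 ^ P.d * (Cγ * P.mesh K ^ 2 * 2) * Real.exp (-(δ * D)) * M := hmain
    _ ≤ 2 * 2 ^ P.d * (Cγ * P.mesh K ^ 2 * 2) * Real.exp (-(Real.log 2 * 4 / (5 * (K₀ : ℝ) + 8) * (D / (P.L : ℝ) ^ K))) * M :=
        mul_le_mul_of_nonneg_right (mul_le_mul_of_nonneg_left hexpD (by positivity)) hM0
    _ = 4 * 2 ^ P.d * Cγ * P.mesh K ^ 2 * Real.exp (-(Real.log 2 * 4 / (5 * (K₀ : ℝ) + 8) * (D / (P.L : ℝ) ^ K))) * M := by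
        ring

/-- **THE SAME, WITH THE CUBE CONDITION AS «`K₀ ∣ M`, `3K₀ ≦ 2M`»** (then `3·L^KK₀ ≦ |T_ε|_μ` at every level `K ≦ K_P`).
[cite: Balaban1982Higgs1, Prop. 2.1 (2.25) p.610; (3.29) p.617] [cite: Balaban1983RegularityDecay, Theorem (1.10) p.573] -/
theorem norm_propagatorK_bgVec_decay (d L : ℕ) (hd : 1 ≤ d) (hL : Odd L ∧ 1 < L) {a : ℝ} (ha : 0 < a) {mu0sq msq : ℝ}
    (hmu : 0 < mu0sq) (hmsq : 0 < msq) (N : ℕ) (C : ChargeData N) (ε₀ : ℝ) :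
    ∃ c₀ : ℝ, 0 < c₀ ∧ ∃ K₀min : ℕ, ∃ cA δA : ℕ → ℝ, (∀ K₀, 0 < cA K₀ ∧ 0 < δA K₀) ∧ ∀ K₀ : ℕ, K₀min ≤ K₀ →
      ∀ (P : HiggsLattice.Params) (_S : Shape P), P.d = d → P.L = L → K₀ ∣ P.M → 3 * K₀ ≤ 2 * P.M →
      ∀ {K : ℕ}, 1 ≤ K → K ≤ P.K → P.mesh K ≤ ε₀ →
      ∀ {r : ℝ}, r * P.mesh K ≤ cA K₀ →
      ∀ A : HiggsLattice.VecField P K, (∀ x, ‖toSite A x‖ ≤ r) →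
        ∀ (g : HiggsLattice.ScalarField P 0 N) (M D : ℝ), (∀ x, ‖g x‖ ≤ M) → 0 ≤ D →
          ∀ x, (∀ z, g z ≠ 0 → D ≤ (HiggsLattice.Site.tdist x z : ℝ)) →
            ‖propagatorK C Finset.univ (bgVec mu0sq a K A) msq a K g x‖
              ≤ c₀ * P.mesh K ^ 2 * Real.exp (-(δA K₀ * (D / (P.L : ℝ) ^ K))) * M := by
  obtain ⟨c₀, hc₀, K₀min, cA, δA, hcδ, h⟩ := norm_propagatorK_bgVec_decay_of_cubes d L hd hL ha hmu hmsq N C ε₀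
  exact ⟨c₀, hc₀, K₀min, cA, δA, hcδ, fun K₀ hK₀ P S hPd hPL hK₀M h3M K hK1 hK hε r hr A hA g M D hg hD0 x hD =>
    h K₀ hK₀ P S hPd hPL hK₀M hK1 hK (three_half_le_sites hK h3M) hε hr A hA g M D hg hD0 x hD⟩

/-- **THE SAME WITH BAŁABAN'S OWN CUBES `K₀ = M`** (*"M sufficiently large"* = `M ≧ M_min`; thresholds `c_A(M)`, rate `δ₀(M)` — *"δ₀ …
depending on d, M only"*; the only extra condition is that a cube is not the whole torus: `K < K_P` or `L′_μ ≧ 2`).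
[cite: Balaban1982Higgs1, Prop. 2.1 p.610 «M sufficiently large»; (1.2) p.604] [cite: Balaban1983RegularityDecay, Theorem p.573; §2 p.575] -/
theorem norm_propagatorK_bgVec_decay_bigBlocks (d L : ℕ) (hd : 1 ≤ d) (hL : Odd L ∧ 1 < L) {a : ℝ} (ha : 0 < a) {mu0sq msq : ℝ}
    (hmu : 0 < mu0sq) (hmsq : 0 < msq) (N : ℕ) (C : ChargeData N) (ε₀ : ℝ) :
    ∃ c₀ : ℝ, 0 < c₀ ∧ ∃ Mmin : ℕ, ∃ cA δA : ℕ → ℝ, (∀ M, 0 < cA M ∧ 0 < δA M) ∧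
      ∀ (P : HiggsLattice.Params) (_S : Shape P), P.d = d → P.L = L → Mmin ≤ P.M →
      ∀ {K : ℕ}, 1 ≤ K → K ≤ P.K → (K < P.K ∨ ∀ μ, 2 ≤ P.Lp μ) → P.mesh K ≤ ε₀ →
      ∀ {r : ℝ}, r * P.mesh K ≤ cA P.M →
      ∀ A : HiggsLattice.VecField P K, (∀ x, ‖toSite A x‖ ≤ r) →
        ∀ (g : HiggsLattice.ScalarField P 0 N) (M D : ℝ), (∀ x, ‖g x‖ ≤ M) → 0 ≤ D →
          ∀ x, (∀ z, g z ≠ 0 → D ≤ (HiggsLattice.Site.tdist x z : ℝ)) →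
            ‖propagatorK C Finset.univ (bgVec mu0sq a K A) msq a K g x‖
              ≤ c₀ * P.mesh K ^ 2 * Real.exp (-(δA P.M * (D / (P.L : ℝ) ^ K))) * M := by
  obtain ⟨c₀, hc₀, K₀min, cA, δA, hcδ, h⟩ := norm_propagatorK_bgVec_decay_of_cubes d L hd hL ha hmu hmsq N C ε₀
  refine ⟨c₀, hc₀, K₀min, cA, δA, hcδ, fun P S hPd hPL hMmin K hK1 hK hroom hε r hr A hA g M D hg hD0 x hD =>
    h P.M hMmin P S hPd hPL (dvd_refl _) hK1 hK ?_ hε hr A hA g M D hg hD0 x hD⟩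
  -- `3·L^K·M ≦ 2·L^{K_P}·M·L′_μ`
  intro μ
  have hL3 : 3 ≤ P.L := by
    rw [hPL]; obtain ⟨⟨t, ht⟩, h1⟩ := hL; omega
  unfold half HiggsLattice.Params.sitesPerDir
  have hLp := P.hLp μ
  have hM := P.hM
  rcases hroom with hlt | hLp2
  · have hpow : P.L * P.L ^ K ≤ P.L ^ (P.K - 0) := by
      rw [← pow_succ']; exact Nat.pow_le_pow_right P.hL (by omega)
    calc 3 * (P.L ^ K * P.M) ≤ P.L * (P.L ^ K * P.M) := Nat.mul_le_mul_right _ hL3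
      _ = (P.L * P.L ^ K) * P.M * 1 := by ring
      _ ≤ P.L ^ (P.K - 0) * P.M * P.Lp μ := Nat.mul_le_mul (Nat.mul_le_mul_right _ hpow) hLp
      _ ≤ 2 * (P.L ^ (P.K - 0) * P.M * P.Lp μ) := Nat.le_mul_of_pos_left _ (by norm_num)
  · have hpow : P.L ^ K ≤ P.L ^ (P.K - 0) := Nat.pow_le_pow_right P.hL (by omega)
    have h2 := hLp2 μ
    calc 3 * (P.L ^ K * P.M) ≤ 4 * (P.L ^ K * P.M) := Nat.mul_le_mul_right _ (by norm_num)
      _ = 2 * (P.L ^ K * P.M * 2) := by ring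
      _ ≤ 2 * (P.L ^ (P.K - 0) * P.M * P.Lp μ) :=
          Nat.mul_le_mul_left 2 (Nat.mul_le_mul (Nat.mul_le_mul_right _ hpow) h2)

end Main

end Literature.MathematicalPhysics.QuantumFieldTheory.Balaban1983to89.B1Ineq225DecayBackgroundTorus
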